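import Literature.MathematicalPhysics.QuantumFieldTheory.ConformalBootstrap3D.PointKernelK57Data
import Literature.MathematicalPhysics.QuantumFieldTheory.ConformalBootstrap3D.PointKernelParts

/-!
# K57 certificate, kernel part file P21: one-cell head segments 188, 189 in level ranges

The head cells whose kernel evaluation exceeds one `decide` are one-cell segments of `hsegsK57`; each is
checked by `PCert.hPartSideOK` (side conditions) and `PCert.hPartOK` per level range `[n_lo, n_lo + count)`
against an integer claim, the claims summing to `≥ 0` (`PointKernel.partsOK`); soundness is
`PCert.hParts_sound` (`PointKernelParts`).  The part files `P1, P2, …` are mutually independent (each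
imports only the data file); the ranges of one cell may span several of them, and the per-cell
conclusions `hparts_i` / `hcell_i` of those cells are assembled in `PointKernelK57.lean`.
Estimated kernel time 127 s.
-/

set_option maxRecDepth 100000
set_option maxHeartbeats 0

namespace Literature.MathematicalPhysics.QuantumFieldTheory.ConformalBootstrap3D.PointKernelK57

open Literature.MathematicalPhysics.QuantumFieldTheory.ConformalBootstrap3D.PointKernel

/-- levels `[0, 27)` of segment 188: partial lower sum `≥` claim. [folklore] -/
theorem part_188_0 : certK57.hPartOK (PCert.segAt hsegsK57 188) JHK57 0 27 (-10871136021403944432778199344273735862) = true := by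
  decide +kernel

/-- levels `[27, 31)` of segment 188: partial lower sum `≥` claim. [folklore] -/
theorem part_188_1 : certK57.hPartOK (PCert.segAt hsegsK57 188) JHK57 27 4 (10871136021403944432778199344273735862) = true := by
  decide +kernel

/-- one-cell segment 189 (row 8, cell `[291/32, 73/8]`, chord, `n_F = 26`,
1 level ranges): side conditions. [folklore] -/
theorem pside_189 : certK57.hPartSideOK (PCert.segAt hsegsK57 189) JHK57 = true := by
  decide +kernel

/-- its level ranges `(n_lo, count, claim)`. [folklore] -/
def parts_189 : List (ℕ × ℕ × ℤ) := [(0, 27, 0)]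

/-- the ranges tile `[0, n_F]` and the claims sum to `≥ 0`. [folklore] -/
theorem pcov_189 : PointKernel.partsOK 26 parts_189 = true := by
  decide +kernel

/-- levels `[0, 27)` of segment 189: partial lower sum `≥` claim. [folklore] -/
theorem part_189_0 : certK57.hPartOK (PCert.segAt hsegsK57 189) JHK57 0 27 (0) = true := by
  decide +kernel

end Literature.MathematicalPhysics.QuantumFieldTheory.ConformalBootstrap3D.PointKernelK57
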